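import Summits.QuantumFields.YangMills.Theorems.ColdStartUniversalityShenZhuZhuFunctionalInequalitiesSU2
import Literature.MathematicalPhysics.QuantumFieldTheory.LatticeYangMillsUniformLogSobolev
import HarnessLib

/-!
# Route `ColdStartUniversality` (fixed-cut-off package): the carré du champ of a pulled-back cylinder function IS twice the sum of Shen–Zhu–Zhu's
# squared link gradients — `Γ^A(f∘Ψ)(V) = 2·Σ_(e∈Λ) |∇_e F|²(U∘torusEdge)` in the `linkGradSq` currency of the tree's kernel log-Sobolev fact

Helper file (seat `ym-line-csu-p1`, g38; `--supports stmt-QuantumFields-24809`).  The Literature file `LatticeYangMillsUniformLogSobolev` measures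
gradients of a cylinder function `F = f((U_e)_(e∈Λ))` by `linkGradSq Λ f e M = Σ_α (d/dt f(M with M_e ↦ e^(tY_α)M_e)|₀)²` (left perturbations in
the Parseval frame `(Y_α)` of `𝔰𝔲(N)` — Shen–Zhu–Zhu's `|∇_e F|²`, §2 p. 10–11, (1.8)).  The seat's Bakry–Émery files measure them by the coordinate
carré du champ `Γ^A(g) = Σ_(ij) ∂_ig ∂_jg (σσᵀ)_(ij)` of the SZZ generator.  For `SU(2)` on the torus `(ℤ/L)³` and the pull-back
`g = f ∘ Ψ_L` (`Ψ_L` reads the link matrices at the projected edges `torusEdge L e`, `e ∈ Λ ⊆ E⁺(ℤ³)`, projecting injectively):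
* ★ `sum_frameDeriv_sq_eq_two_mul_sum_sq_dirDeriv` — per link `ẽ`: `Σ_ν (W_(ẽ,ν)u)² = 2Σ_α (Du(coords V)[δ_ẽ(Y_α Q_ẽ)])²` (noise basis vs Parseval
  frame, left/right invariance; the identity behind g38's `sum_frameDeriv_sq_le_of_linkLipschitz`);
* ★★ `carre_eq_two_mul_sum_linkGradSq` — `Γ^A(f∘Ψ_L)(V) = 2·Σ_(e∈Λ) linkGradSq Λ f e ((U_(torusEdge L e'))_(e'))`: links of the torus outside the
  image of `Λ` do not contribute (`g` does not depend on them), and at `ẽ = torusEdge L e` the directional derivative `Du[δ_ẽ(Y Q_ẽ)]` is the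
  `t`-derivative of `f` along `M_e ↦ e^(tY)M_e` (`hasDerivAt_comp_coords_multiFlow`).
With `…FunctionalInequalitiesOfEnergy` this gives Shen–Zhu–Zhu's (4.11) on every torus and (4.12)–(4.13) for every infinite-volume limit point
in the printed GRADIENT form (sequel).  THEOREMS ONLY, no definition, no sorry; [folklore] bookkeeping.  HONEST FRAMING: fixed cut-off; no crux,
rung or summit statement is proved; the Yang–Mills mass gap is NOT proved.
-/

set_option autoImplicit false

noncomputable section

namespace Summit.QuantumFields.YangMills.Theorems.ColdStartUniversality

open MeasureTheory ProbabilityTheory Matrix Complex Finset Filter Set Metric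
open scoped ComplexConjugate BigOperators Matrix NNReal ENNReal Topology ContDiff
open Literature.Probability.Process Literature.MathematicalPhysics.QuantumFieldTheory
open Literature.MathematicalPhysics.QuantumLattice (fundamentalRep fundamentalLatticeRep continuous_fundamentalRep fundamentalRep_apply
  torusEdge torusLift LGConfig)

variable {L : ℕ} [NeZero L]

/-! ## §1. The per-link frame sum of squares through the Parseval frame -/

omit [NeZero L] in
/-- ★ **Noise-frame sum of squares = twice the Parseval-frame sum of squared tangential derivatives.**  For every `u`, link `e` and
configuration `V`: `Σ_ν (W_(e,ν)u(coords V))² = 2·Σ_α (Du(coords V)[δ_e(Y_α Q_e)])²`, `Q_e = ρ(V_e)`, `(Y_α)` the Parseval frame of `𝔰𝔲(2)`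
(`SUNBakryEmery.frame`), `δ_e(A)` the coordinate vector supported on the link `e` with the real coordinates of `A`.
[cite: ShenZhuZhu2022, §2 (2.3)–(2.4) (p. 10)] -/
theorem sum_frameDeriv_sq_eq_two_mul_sum_sq_dirDeriv (u : (Edge 3 L × Fin 2 × Fin 2 × Bool → ℝ) → ℝ) (e : Edge 3 L) (V : (GaugeConfig 3 L (Matrix.specialUnitaryGroup (Fin 2) ℂ))) :
    ∑ ν : NoiseIdx (fundamentalLatticeRep 2).N,
        fderiv ℝ u ((fun (V : GaugeConfig 3 L (Matrix.specialUnitaryGroup (Fin 2) ℂ)) (q : Edge 3 L × Fin (fundamentalLatticeRep 2).N × Fin (fundamentalLatticeRep 2).N × Bool) => (fun z : ℂ => if q.2.2.2 then z.im else z.re) ((fundamentalRep (Fin 2) (V q.1) : Matrix (Fin 2) (Fin 2) ℂ) q.2.1 q.2.2.1)) V) (fun q : Edge 3 L × Fin (fundamentalLatticeRep 2).N × Fin (fundamentalLatticeRep 2).N × Bool => if (e, ν).1 = q.1 then (fun z : ℂ => if q.2.2.2 then z.im else z.re) (((Real.sqrt 2 : ℂ) • ((fundamentalLatticeRep 2).lieProj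 (noiseDir (e, ν).2) * (fun (ee : Edge 3 L) => Matrix.of fun (i j : Fin (fundamentalLatticeRep 2).N) => (((fun (V : GaugeConfig 3 L (Matrix.specialUnitaryGroup (Fin 2) ℂ)) (q : Edge 3 L × Fin (fundamentalLatticeRep 2).N × Fin (fundamentalLatticeRep 2).N × Bool) => (fun z : ℂ => if q.2.2.2 then z.im else z.re) ((fundamentalRep (Fin 2) (V q.1) : Matrix (Fin 2) (Fin 2) ℂ) q.2.1 q.2.2.1)) V (ee, i, j, false) : ℝ) : ℂ) + (((fun (V : GaugeConfig 3 L (Matrix.specialUnitaryGroup (Fin 2) ℂ)) (q : Edge 3 L × Fin (fundamentalLatticeRep 2).N × Fin (fundamentalLatticeRep 2).N × Bool) => (fun z : ℂ => if q.2.2.2 then z.im else z.re) ((fundamentalRep (Fin 2) (V q.1) : Matrix (Fin 2) (Fin 2) ℂ) q.2.1 q.2.2.1)) V (ee, i, j, true) : ℝ) : ℂ) * Complex.I) q.1)) q.2.1 q.2.2.1) else 0) * fderiv ℝ u ((fun (V : GaugeConfig 3 L (Matrix.specialUnitaryGroup (Fin 2) ℂ)) (q : Edge 3 L × Fin (fundamentalLatticeRep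 2).N × Fin (fundamentalLatticeRep 2).N × Bool) => (fun z : ℂ => if q.2.2.2 then z.im else z.re) ((fundamentalRep (Fin 2) (V q.1) : Matrix (Fin 2) (Fin 2) ℂ) q.2.1 q.2.2.1)) V) (fun q : Edge 3 L × Fin (fundamentalLatticeRep 2).N × Fin (fundamentalLatticeRep 2).N × Bool => if (e, ν).1 = q.1 then (fun z : ℂ => if q.2.2.2 then z.im else z.re) (((Real.sqrt 2 : ℂ) • ((fundamentalLatticeRep 2).lieProj (noiseDir (e, ν).2) * (fun (ee : Edge 3 L) => Matrix.of fun (i j : Fin (fundamentalLatticeRep 2).N) => (((fun (V : GaugeConfig 3 L (Matrix.specialUnitaryGroup (Fin 2) ℂ)) (q : Edge 3 L × Fin (fundamentalLatticeRep 2).N × Fin (fundamentalLatticeRep 2).N × Bool) => (fun z : ℂ => if q.2.2.2 then z.im else z.re) ((fundamentalRep (Fin 2) (V q.1) : Matrix (Fin 2) (Fin 2) ℂ) q.2.1 q.2.2.1)) V (ee, i, j, false) : ℝ) : ℂ) + (((fun (V : GaugeConfig 3 L (Matrix.specialUnitaryGroup (Fin 2) ℂ)) (q : Edge 3 L × Fin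 (fundamentalLatticeRep 2).N × Fin (fundamentalLatticeRep 2).N × Bool) => (fun z : ℂ => if q.2.2.2 then z.im else z.re) ((fundamentalRep (Fin 2) (V q.1) : Matrix (Fin 2) (Fin 2) ℂ) q.2.1 q.2.2.1)) V (ee, i, j, true) : ℝ) : ℂ) * Complex.I) q.1)) q.2.1 q.2.2.1) else 0) =
      2 * ∑ α : SUNBakryEmery.FrameIdx (fundamentalLatticeRep 2).N,
        (fderiv ℝ u ((fun (V : GaugeConfig 3 L (Matrix.specialUnitaryGroup (Fin 2) ℂ)) (q : Edge 3 L × Fin (fundamentalLatticeRep 2).N × Fin (fundamentalLatticeRep 2).N × Bool) => (fun z : ℂ => if q.2.2.2 then z.im else z.re) ((fundamentalRep (Fin 2) (V q.1) : Matrix (Fin 2) (Fin 2) ℂ) q.2.1 q.2.2.1)) V) (fun q : Edge 3 L × Fin (fundamentalLatticeRep 2).N × Fin (fundamentalLatticeRep 2).N × Bool => if e = q.1 then (fun z : ℂ => if q.2.2.2 then z.im else z.re)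
          ((SUNBakryEmery.frame α * (fundamentalLatticeRep 2).ρ (V e)) q.2.1 q.2.2.1) else 0)) ^ 2 := by
  classical
  have hN : (fundamentalLatticeRep 2).N ≠ 0 := by rw [Literature.MathematicalPhysics.QuantumLattice.fundamentalLatticeRep_N]; norm_num
  set Q : Matrix (Fin (fundamentalLatticeRep 2).N) (Fin (fundamentalLatticeRep 2).N) ℂ := (fundamentalLatticeRep 2).ρ (V e) with hQdef
  have hQu : Q ∈ Matrix.unitaryGroup (Fin (fundamentalLatticeRep 2).N) ℂ := Matrix.specialUnitaryGroup_le_unitaryGroup (V e).2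
  have hQ1 : Q * Qᴴ = 1 := by
    have h := Matrix.mem_unitaryGroup_iff.1 hQu
    rwa [Matrix.star_eq_conjTranspose] at h
  have hQ2 : Qᴴ * Q = 1 := by
    have h := Matrix.mem_unitaryGroup_iff'.1 hQu
    rwa [Matrix.star_eq_conjTranspose] at h
  set ι : Matrix (Fin (fundamentalLatticeRep 2).N) (Fin (fundamentalLatticeRep 2).N) ℂ → (Edge 3 L × Fin (fundamentalLatticeRep 2).N × Fin (fundamentalLatticeRep 2).N × Bool → ℝ) := fun M q =>
    if e = q.1 then (fun z : ℂ => if q.2.2.2 then z.im else z.re) (M q.2.1 q.2.2.1) else 0 with hιdef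
  have hιadd : ∀ M M', ι (M + M') = ι M + ι M' := by
    intro M M'; funext q; obtain ⟨e', i, j, b⟩ := q
    rw [Pi.add_apply]
    by_cases h : e = e' <;> cases b <;>
      simp only [hιdef, h, if_true, if_false, Bool.false_eq_true, Matrix.add_apply, Complex.add_re,
        Complex.add_im, add_zero]
  have hιsmul : ∀ (a : ℝ) M, ι (a • M) = a • ι M := by
    intro a M; funext q; obtain ⟨e', i, j, b⟩ := q
    rw [Pi.smul_apply]
    by_cases h : e = e' <;> cases b <;>
      simp only [hιdef, h, if_true, if_false, Bool.false_eq_true, Matrix.smul_apply, Complex.smul_re,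
        Complex.smul_im, smul_eq_mul, mul_zero]
  let ιl : Matrix (Fin (fundamentalLatticeRep 2).N) (Fin (fundamentalLatticeRep 2).N) ℂ →ₗ[ℝ] (Edge 3 L × Fin (fundamentalLatticeRep 2).N × Fin (fundamentalLatticeRep 2).N × Bool → ℝ) := { toFun := ι, map_add' := hιadd, map_smul' := hιsmul }
  let lam : Matrix (Fin (fundamentalLatticeRep 2).N) (Fin (fundamentalLatticeRep 2).N) ℂ →ₗ[ℝ] ℝ := (fderiv ℝ u ((fun (V : GaugeConfig 3 L (Matrix.specialUnitaryGroup (Fin 2) ℂ)) (q : Edge 3 L × Fin (fundamentalLatticeRep 2).N × Fin (fundamentalLatticeRep 2).N × Bool) => (fun z : ℂ => if q.2.2.2 then z.im else z.re) ((fundamentalRep (Fin 2) (V q.1) : Matrix (Fin 2) (Fin 2) ℂ) q.2.1 q.2.2.1)) V)).toLinearMap.comp ιl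
  have hlam : ∀ M, lam M = fderiv ℝ u ((fun (V : GaugeConfig 3 L (Matrix.specialUnitaryGroup (Fin 2) ℂ)) (q : Edge 3 L × Fin (fundamentalLatticeRep 2).N × Fin (fundamentalLatticeRep 2).N × Bool) => (fun z : ℂ => if q.2.2.2 then z.im else z.re) ((fundamentalRep (Fin 2) (V q.1) : Matrix (Fin 2) (Fin 2) ℂ) q.2.1 q.2.2.1)) V) (ι M) := fun M => rfl
  have hreb := rebuild_coords_of (L := L) V
  have hRe : (fun (ee : Edge 3 L) => Matrix.of fun (i j : Fin (fundamentalLatticeRep 2).N) => (((fun (V : GaugeConfig 3 L (Matrix.specialUnitaryGroup (Fin 2) ℂ)) (q : Edge 3 L × Fin (fundamentalLatticeRep 2).N × Fin (fundamentalLatticeRep 2).N × Bool) => (fun z : ℂ => if q.2.2.2 then z.im else z.re) ((fundamentalRep (Fin 2) (V q.1) : Matrix (Fin 2) (Fin 2) ℂ) q.2.1 q.2.2.1)) V (ee, i, j, false) : ℝ) : ℂ) + (((fun (V : GaugeConfig 3 L (Matrix.specialUnitaryGroup (Fin 2) ℂ)) (q : Edge 3 L × Fin (fundamentalLatticeRep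 2).N × Fin (fundamentalLatticeRep 2).N × Bool) => (fun z : ℂ => if q.2.2.2 then z.im else z.re) ((fundamentalRep (Fin 2) (V q.1) : Matrix (Fin 2) (Fin 2) ℂ) q.2.1 q.2.2.1)) V (ee, i, j, true) : ℝ) : ℂ) * Complex.I) e = Q := congrFun hreb e
  have hW : ∀ ν : NoiseIdx (fundamentalLatticeRep 2).N,
      fderiv ℝ u ((fun (V : GaugeConfig 3 L (Matrix.specialUnitaryGroup (Fin 2) ℂ)) (q : Edge 3 L × Fin (fundamentalLatticeRep 2).N × Fin (fundamentalLatticeRep 2).N × Bool) => (fun z : ℂ => if q.2.2.2 then z.im else z.re) ((fundamentalRep (Fin 2) (V q.1) : Matrix (Fin 2) (Fin 2) ℂ) q.2.1 q.2.2.1)) V) (fun q : Edge 3 L × Fin (fundamentalLatticeRep 2).N × Fin (fundamentalLatticeRep 2).N × Bool => if (e, ν).1 = q.1 then (fun z : ℂ => if q.2.2.2 then z.im else z.re) (((Real.sqrt 2 : ℂ) • ((fundamentalLatticeRep 2).lieProj (noiseDir (e, ν).2) * (fun (ee : Edge 3 L) => Matrix.of fun (i j : Fin (fundamentalLatticeRep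 2).N) => (((fun (V : GaugeConfig 3 L (Matrix.specialUnitaryGroup (Fin 2) ℂ)) (q : Edge 3 L × Fin (fundamentalLatticeRep 2).N × Fin (fundamentalLatticeRep 2).N × Bool) => (fun z : ℂ => if q.2.2.2 then z.im else z.re) ((fundamentalRep (Fin 2) (V q.1) : Matrix (Fin 2) (Fin 2) ℂ) q.2.1 q.2.2.1)) V (ee, i, j, false) : ℝ) : ℂ) + (((fun (V : GaugeConfig 3 L (Matrix.specialUnitaryGroup (Fin 2) ℂ)) (q : Edge 3 L × Fin (fundamentalLatticeRep 2).N × Fin (fundamentalLatticeRep 2).N × Bool) => (fun z : ℂ => if q.2.2.2 then z.im else z.re) ((fundamentalRep (Fin 2) (V q.1) : Matrix (Fin 2) (Fin 2) ℂ) q.2.1 q.2.2.1)) V (ee, i, j, true) : ℝ) : ℂ) * Complex.I) q.1)) q.2.1 q.2.2.1) else 0) = lam ((Real.sqrt 2 : ℂ) • ((fundamentalLatticeRep 2).lieProj (noiseDir ν) * Q)) := by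
    intro ν
    rw [hlam]
    congr 1
    funext q
    by_cases hq : e = q.1
    · have h1 : ((e, ν) : Edge 3 L × NoiseIdx (fundamentalLatticeRep 2).N).1 = q.1 := hq
      rw [if_pos h1, ← hq, hRe]
      simp only [hιdef, if_pos hq]
    · have h1 : ¬ ((e, ν) : Edge 3 L × NoiseIdx (fundamentalLatticeRep 2).N).1 = q.1 := hq
      rw [if_neg h1]
      simp only [hιdef, if_neg hq]
  have h1 : ∑ ν : NoiseIdx (fundamentalLatticeRep 2).N, fderiv ℝ u ((fun (V : GaugeConfig 3 L (Matrix.specialUnitaryGroup (Fin 2) ℂ)) (q : Edge 3 L × Fin (fundamentalLatticeRep 2).N × Fin (fundamentalLatticeRep 2).N × Bool) => (fun z : ℂ => if q.2.2.2 then z.im else z.re) ((fundamentalRep (Fin 2) (V q.1) : Matrix (Fin 2) (Fin 2) ℂ) q.2.1 q.2.2.1)) V) (fun q : Edge 3 L × Fin (fundamentalLatticeRep 2).N × Fin (fundamentalLatticeRep 2).N × Bool => if (e, ν).1 = q.1 then (fun z : ℂ => if q.2.2.2 then z.im else z.re) (((Real.sqrt 2 : ℂ) • ((fundamentalLatticeRep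 2).lieProj (noiseDir (e, ν).2) * (fun (ee : Edge 3 L) => Matrix.of fun (i j : Fin (fundamentalLatticeRep 2).N) => (((fun (V : GaugeConfig 3 L (Matrix.specialUnitaryGroup (Fin 2) ℂ)) (q : Edge 3 L × Fin (fundamentalLatticeRep 2).N × Fin (fundamentalLatticeRep 2).N × Bool) => (fun z : ℂ => if q.2.2.2 then z.im else z.re) ((fundamentalRep (Fin 2) (V q.1) : Matrix (Fin 2) (Fin 2) ℂ) q.2.1 q.2.2.1)) V (ee, i, j, false) : ℝ) : ℂ) + (((fun (V : GaugeConfig 3 L (Matrix.specialUnitaryGroup (Fin 2) ℂ)) (q : Edge 3 L × Fin (fundamentalLatticeRep 2).N × Fin (fundamentalLatticeRep 2).N × Bool) => (fun z : ℂ => if q.2.2.2 then z.im else z.re) ((fundamentalRep (Fin 2) (V q.1) : Matrix (Fin 2) (Fin 2) ℂ) q.2.1 q.2.2.1)) V (ee, i, j, true) : ℝ) : ℂ) * Complex.I) q.1)) q.2.1 q.2.2.1) else 0) * fderiv ℝ u ((fun (V : GaugeConfig 3 L (Matrix.specialUnitaryGroup (Fin 2) ℂ)) (q : Edge 3 L ×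 Fin (fundamentalLatticeRep 2).N × Fin (fundamentalLatticeRep 2).N × Bool) => (fun z : ℂ => if q.2.2.2 then z.im else z.re) ((fundamentalRep (Fin 2) (V q.1) : Matrix (Fin 2) (Fin 2) ℂ) q.2.1 q.2.2.1)) V) (fun q : Edge 3 L × Fin (fundamentalLatticeRep 2).N × Fin (fundamentalLatticeRep 2).N × Bool => if (e, ν).1 = q.1 then (fun z : ℂ => if q.2.2.2 then z.im else z.re) (((Real.sqrt 2 : ℂ) • ((fundamentalLatticeRep 2).lieProj (noiseDir (e, ν).2) * (fun (ee : Edge 3 L) => Matrix.of fun (i j : Fin (fundamentalLatticeRep 2).N) => (((fun (V : GaugeConfig 3 L (Matrix.specialUnitaryGroup (Fin 2) ℂ)) (q : Edge 3 L × Fin (fundamentalLatticeRep 2).N × Fin (fundamentalLatticeRep 2).N × Bool) => (fun z : ℂ => if q.2.2.2 then z.im else z.re) ((fundamentalRep (Fin 2) (V q.1) : Matrix (Fin 2) (Fin 2) ℂ) q.2.1 q.2.2.1)) V (ee, i, j, false) : ℝ) : ℂ) + (((fun (V : GaugeConfig 3 L (Matrix.specialUnitaryGroup (Fin 2) ℂ))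 (q : Edge 3 L × Fin (fundamentalLatticeRep 2).N × Fin (fundamentalLatticeRep 2).N × Bool) => (fun z : ℂ => if q.2.2.2 then z.im else z.re) ((fundamentalRep (Fin 2) (V q.1) : Matrix (Fin 2) (Fin 2) ℂ) q.2.1 q.2.2.1)) V (ee, i, j, true) : ℝ) : ℂ) * Complex.I) q.1)) q.2.1 q.2.2.1) else 0) =
      ∑ ν : NoiseIdx 2, lam ((Real.sqrt 2 : ℂ) • ((fundamentalLatticeRep 2).lieProj (noiseDir ν) * Q)) ^ 2 :=
    Finset.sum_congr rfl fun ν _ => by rw [hW ν, sq]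
  rw [h1, sum_sq_apply_noise_eq_two_mul_sum_sq_apply_mul_frame lam hQ1 hQ2,
    ← SUNBakryEmery.sum_sq_apply_frame_mul_eq_sum_sq_apply_mul_frame hN lam hQ1 hQ2]
  simp only [hlam, hιdef]

/-! ## §2. The carré du champ of a pulled-back cylinder function in the `linkGradSq` currency -/

section Dictionary

open scoped Matrix.Norms.Frobenius

/-- ★★ **`Γ^A(f ∘ Ψ_L)(V) = 2·Σ_(e∈Λ) linkGradSq Λ f e (U∘torusEdge L)`.**  Let `Λ ⊆ E⁺(ℤ³)` be a finite edge set that the torus projection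
`torusEdge L` maps injectively, `f` a smooth function of the link matrices over `Λ`, and `g = f∘Ψ_L` its pull-back to the real link coordinates of
the torus (`Ψ_L(y)_e =` the matrix rebuilt from the coordinates `y` at the torus link `torusEdge L e`).  Then for every torus configuration `V`
the carré du champ of the SZZ coordinate generator of `g` is twice the sum over `e ∈ Λ` of Shen–Zhu–Zhu's squared link gradients
`linkGradSq Λ f e` evaluated at the matrices `(V_(torusEdge L e'))_(e'∈Λ)`: torus links outside the image of `Λ` do not contribute, and at
`torusEdge L e` the tangential derivatives along `Y_α Q` are the `t`-derivatives along `M_e ↦ e^(tY_α)M_e`.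
[cite: ShenZhuZhu2022, §2 (1.8) and (2.3)–(2.4)] -/
theorem carre_eq_two_mul_sum_linkGradSq (L : ℕ) [NeZero L] (β' : ℝ)
    (Λ : Finset (Literature.MathematicalPhysics.QuantumLattice.ZdEdge 3)) (hinj : Set.InjOn (torusEdge (d := 3) L) ↑Λ)
    (f : (↥Λ → Matrix (Fin 2) (Fin 2) ℂ) → ℝ) (hf : ContDiff ℝ ∞ f) (V : (GaugeConfig 3 L (Matrix.specialUnitaryGroup (Fin 2) ℂ))) :
    let coords : GaugeConfig 3 L (Matrix.specialUnitaryGroup (Fin 2) ℂ) → (Edge 3 L × Fin 2 × Fin 2 × Bool → ℝ) :=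
      fun V q => (fun z : ℂ => if q.2.2.2 then z.im else z.re)
        ((fundamentalRep (Fin 2) (V q.1) : Matrix (Fin 2) (Fin 2) ℂ) q.2.1 q.2.2.1)
    let A : GaugeConfig 3 L (Matrix.specialUnitaryGroup (Fin 2) ℂ) → (Edge 3 L × Fin 2 × Fin 2 × Bool) →
        (Edge 3 L × Fin 2 × Fin 2 × Bool) → ℝ := fun V i j =>
      ∑ n : Edge 3 L × NoiseIdx 2,
        (if n.1 = i.1 then (fun z : ℂ => if i.2.2.2 then z.im else z.re)
          ((latticeLangevinDynamics (fundamentalLatticeRep 2) β').noise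
            (matrixConfig (fundamentalRep (Fin 2)) V) i.1 n.2 i.2.1 i.2.2.1) else 0) *
        (if n.1 = j.1 then (fun z : ℂ => if j.2.2.2 then z.im else z.re)
          ((latticeLangevinDynamics (fundamentalLatticeRep 2) β').noise
            (matrixConfig (fundamentalRep (Fin 2)) V) j.1 n.2 j.2.1 j.2.2.1) else 0)
    let g : (Edge 3 L × Fin 2 × Fin 2 × Bool → ℝ) → ℝ := fun y => f (fun e : ↥Λ => (fun (ee : Edge 3 L) => Matrix.of fun (i j : Fin (fundamentalLatticeRep 2).N) => ((y (ee, i, j, false) : ℝ) : ℂ) + ((y (ee, i, j, true) : ℝ) : ℂ) * Complex.I) (torusEdge L e.1))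
    (∑ i : Edge 3 L × Fin 2 × Fin 2 × Bool, ∑ j : Edge 3 L × Fin 2 × Fin 2 × Bool, fderiv ℝ g (coords V) (Pi.single i 1) * fderiv ℝ g (coords V) (Pi.single j 1) * A V i j) = 2 * ∑ e : ↥Λ, linkGradSq Λ f e (fun e' : ↥Λ => ((torusLift L V e'.1 : Matrix.specialUnitaryGroup (Fin 2) ℂ) : Matrix (Fin 2) (Fin 2) ℂ)) := by
  intro coords A g
  classical
  -- abbreviations
  set M : ↥Λ → Matrix (Fin 2) (Fin 2) ℂ :=
    fun e' => ((torusLift L V e'.1 : Matrix.specialUnitaryGroup (Fin 2) ℂ) : Matrix (Fin 2) (Fin 2) ℂ) with hM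
  -- the linear read-out `Ψ` and `g = f ∘ Ψ`
  set Ψ : (Edge 3 L × Fin 2 × Fin 2 × Bool → ℝ) → (↥Λ → Matrix (Fin 2) (Fin 2) ℂ) := fun y e => (fun (ee : Edge 3 L) => Matrix.of fun (i j : Fin (fundamentalLatticeRep 2).N) => ((y (ee, i, j, false) : ℝ) : ℂ) + ((y (ee, i, j, true) : ℝ) : ℂ) * Complex.I) (torusEdge L e.1) with hΨ
  have hΨadd : ∀ y y', Ψ (y + y') = Ψ y + Ψ y' := by
    intro y y'; funext e; ext i j
    show (((y + y') (torusEdge L e.1, i, j, false) : ℝ) : ℂ) + (((y + y') (torusEdge L e.1, i, j, true) : ℝ) : ℂ) * Complex.I =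
      ((((y (torusEdge L e.1, i, j, false) : ℝ) : ℂ) + ((y (torusEdge L e.1, i, j, true) : ℝ) : ℂ) * Complex.I) +
        (((y' (torusEdge L e.1, i, j, false) : ℝ) : ℂ) + ((y' (torusEdge L e.1, i, j, true) : ℝ) : ℂ) * Complex.I))
    simp only [Pi.add_apply]
    push_cast; ring
  have hΨsmul : ∀ (a : ℝ) y, Ψ (a • y) = a • Ψ y := by
    intro a y; funext e; ext i j
    show (((a • y) (torusEdge L e.1, i, j, false) : ℝ) : ℂ) + (((a • y) (torusEdge L e.1, i, j, true) : ℝ) : ℂ) * Complex.I =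
      a • ((((y (torusEdge L e.1, i, j, false) : ℝ) : ℂ) + ((y (torusEdge L e.1, i, j, true) : ℝ) : ℂ) * Complex.I))
    simp only [Pi.smul_apply, smul_eq_mul, Complex.real_smul]
    push_cast; ring
  let Ψl : (Edge 3 L × Fin 2 × Fin 2 × Bool → ℝ) →ₗ[ℝ] (↥Λ → Matrix (Fin 2) (Fin 2) ℂ) := { toFun := Ψ, map_add' := hΨadd, map_smul' := hΨsmul }
  let Ψc : (Edge 3 L × Fin 2 × Fin 2 × Bool → ℝ) →L[ℝ] (↥Λ → Matrix (Fin 2) (Fin 2) ℂ) := LinearMap.toContinuousLinearMap Ψl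
  have hΨc : ∀ y, Ψc y = Ψ y := fun y => rfl
  have hgΨ : g = f ∘ Ψc := by funext y; rfl
  have hfd : Differentiable ℝ f := hf.differentiable (by simp)
  have hgd : Differentiable ℝ g := by rw [hgΨ]; exact hfd.comp Ψc.differentiable
  have hfderiv_g : ∀ y v, fderiv ℝ g y v = fderiv ℝ f (Ψ y) (Ψ v) := by
    intro y v
    rw [hgΨ, ((hfd (Ψc y)).hasFDerivAt.comp y Ψc.hasFDerivAt).fderiv]
    rfl
  -- `Ψ (coords V) = M`
  have hreb : ∀ W : (GaugeConfig 3 L (Matrix.specialUnitaryGroup (Fin 2) ℂ)), (fun (ee : Edge 3 L) => Matrix.of fun (i j : Fin (fundamentalLatticeRep 2).N) => ((coords W (ee, i, j, false) : ℝ) : ℂ) + ((coords W (ee, i, j, true) : ℝ) : ℂ) * Complex.I) = fun e => Matrix.of fun i j : Fin (fundamentalLatticeRep 2).N =>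
      (fundamentalRep (Fin 2) (W e) : Matrix (Fin 2) (Fin 2) ℂ) i j := fun W => rebuild_coords_of (L := L) W
  have hΨco : ∀ W : (GaugeConfig 3 L (Matrix.specialUnitaryGroup (Fin 2) ℂ)), Ψ (coords W) = fun e' : ↥Λ => ((torusLift L W e'.1 : Matrix.specialUnitaryGroup (Fin 2) ℂ) : Matrix (Fin 2) (Fin 2) ℂ) := by
    intro W; funext e'
    show (fun (ee : Edge 3 L) => Matrix.of fun (i j : Fin (fundamentalLatticeRep 2).N) => ((coords W (ee, i, j, false) : ℝ) : ℂ) + ((coords W (ee, i, j, true) : ℝ) : ℂ) * Complex.I) (torusEdge L e'.1) = _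
    rw [hreb W]
    rfl
  -- the frame expansion of the carré du champ
  have hframe : (∑ i : Edge 3 L × Fin 2 × Fin 2 × Bool, ∑ j : Edge 3 L × Fin 2 × Fin 2 × Bool, fderiv ℝ g (coords V) (Pi.single i 1) * fderiv ℝ g (coords V) (Pi.single j 1) * A V i j) =
      ∑ n : Edge 3 L × NoiseIdx (fundamentalLatticeRep 2).N, fderiv ℝ g (coords V) (fun q : Edge 3 L × Fin (fundamentalLatticeRep 2).N × Fin (fundamentalLatticeRep 2).N × Bool => if n.1 = q.1 then (fun z : ℂ => if q.2.2.2 then z.im else z.re) (((Real.sqrt 2 : ℂ) • ((fundamentalLatticeRep 2).lieProj (noiseDir n.2) * (fun (ee : Edge 3 L) => Matrix.of fun (i j : Fin (fundamentalLatticeRep 2).N) => ((coords V (ee, i, j, false) : ℝ) : ℂ) + ((coords V (ee, i, j, true) : ℝ) : ℂ) * Complex.I) q.1)) q.2.1 q.2.2.1) else 0) * fderiv ℝ g (coords V) (fun q : Edge 3 L × Fin (fundamentalLatticeRep 2).N × Fin (fundamentalLatticeRep 2).N × Bool => if n.1 = q.1 then (fun z : ℂ => if q.2.2.2 then z.im else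 z.re) (((Real.sqrt 2 : ℂ) • ((fundamentalLatticeRep 2).lieProj (noiseDir n.2) * (fun (ee : Edge 3 L) => Matrix.of fun (i j : Fin (fundamentalLatticeRep 2).N) => ((coords V (ee, i, j, false) : ℝ) : ℂ) + ((coords V (ee, i, j, true) : ℝ) : ℂ) * Complex.I) q.1)) q.2.1 q.2.2.1) else 0) :=
    carre_eq_sum_frameDeriv_mul L β' g g V
  rw [hframe, Fintype.sum_prod_type]
  -- per torus link: the Parseval sum of squared tangential derivatives is `linkGradSq` at the preimage, or zero
  have hterm : ∀ e' : Edge 3 L,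
      ∑ α : SUNBakryEmery.FrameIdx (fundamentalLatticeRep 2).N,
        (fderiv ℝ g (coords V) (fun q : Edge 3 L × Fin (fundamentalLatticeRep 2).N × Fin (fundamentalLatticeRep 2).N × Bool => if e' = q.1 then (fun z : ℂ => if q.2.2.2 then z.im else z.re)
          ((SUNBakryEmery.frame α * (fundamentalLatticeRep 2).ρ (V e')) q.2.1 q.2.2.1) else 0)) ^ 2 =
      ∑ e : ↥Λ, if torusEdge L e.1 = e' then linkGradSq Λ f e M else 0 := by
    intro e'
    by_cases hex : ∃ e₀ : ↥Λ, torusEdge L e₀.1 = e'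
    · obtain ⟨e₀, he₀⟩ := hex
      have huniq : ∀ e : ↥Λ, e ≠ e₀ → torusEdge L e.1 ≠ e' := by
        intro e hne hEq
        exact hne (Subtype.ext (hinj e.2 e₀.2 (hEq.trans he₀.symm)))
      rw [Finset.sum_eq_single e₀ (fun e _ hne => if_neg (huniq e hne)) (fun h => absurd (Finset.mem_univ _) h), if_pos he₀]
      have hN : (fundamentalLatticeRep 2).N ≠ 0 := by rw [Literature.MathematicalPhysics.QuantumLattice.fundamentalLatticeRep_N]; norm_num
      -- the derivative of `f` along `M_(e₀) ↦ e^(tY) M_(e₀)` is `Dg(coords V)[δ_(e')(Y Q_(e'))]`, for every `Y ∈ 𝔰𝔲(2)`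
      have hder : ∀ {Y : Matrix (Fin (fundamentalLatticeRep 2).N) (Fin (fundamentalLatticeRep 2).N) ℂ}, Yᴴ = -Y → Y.trace = 0 →
          deriv (fun t : ℝ => f (Function.update M e₀ (NormedSpace.exp (t • Y) * (fundamentalLatticeRep 2).ρ (V e')))) 0 =
            fderiv ℝ g (coords V) (fun q : Edge 3 L × Fin (fundamentalLatticeRep 2).N × Fin (fundamentalLatticeRep 2).N × Bool => if e' = q.1 then (fun z : ℂ => if q.2.2.2 then z.im else z.re)
              ((Y * (fundamentalLatticeRep 2).ρ (V e')) q.2.1 q.2.2.1) else 0) := by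
        intro Y hY hY0
        set X : Edge 3 L → Matrix (Fin (fundamentalLatticeRep 2).N) (Fin (fundamentalLatticeRep 2).N) ℂ := fun e'' => if e'' = e' then Y else 0 with hXdef
        have hXskew : ∀ e'', (X e'')ᴴ = -(X e'') := fun e'' => by
          by_cases h : e'' = e'
          · simp only [hXdef, h, if_true]; exact hY
          · simp only [hXdef, h, if_false, Matrix.conjTranspose_zero, neg_zero]
        have hXtr : ∀ e'', (X e'').trace = 0 := fun e'' => by
          by_cases h : e'' = e'
          · simp only [hXdef, h, if_true]; exact hY0
          · simp only [hXdef, h, if_false, Matrix.trace_zero]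
        set us : ℝ → (GaugeConfig 3 L (Matrix.specialUnitaryGroup (Fin 2) ℂ)) := fun s => (fun e'' => SUNBakryEmery.expSU (N := 2) (Y := Matrix.of fun i j : Fin 2 => X e'' i j) (hXskew e'') (hXtr e'') s) with hus
        have hus0 : us 0 * V = V := by
          funext e''
          have h1 : (SUNBakryEmery.expSU (N := 2) (Y := Matrix.of fun i j : Fin 2 => X e'' i j) (hXskew e'') (hXtr e'') (0 : ℝ)) = 1 :=
            Subtype.ext (by rw [SUNBakryEmery.coe_expSU, zero_smul, NormedSpace.exp_zero]; rfl)
          simp only [hus, Pi.mul_apply, h1, one_mul]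
        have hfix : ∀ (s : ℝ) (e'' : Edge 3 L), e'' ≠ e' → (us s * V) e'' = V e'' := by
          intro s e'' he
          have h1 : (SUNBakryEmery.expSU (N := 2) (Y := Matrix.of fun i j : Fin 2 => X e'' i j) (hXskew e'') (hXtr e'') s) = 1 := by
            apply Subtype.ext
            rw [SUNBakryEmery.coe_expSU]
            have hz : (Matrix.of fun i j : Fin 2 => X e'' i j) = 0 := by
              ext i j; simp only [hXdef, he, if_false, Matrix.of_apply]; rfl
            rw [hz, smul_zero, NormedSpace.exp_zero]; rfl
          simp only [hus, Pi.mul_apply, h1, one_mul]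
        have hmove : ∀ s : ℝ, (fundamentalLatticeRep 2).ρ ((us s * V) e') =
            NormedSpace.exp (s • Y) * (fundamentalLatticeRep 2).ρ (V e') := by
          intro s
          have hof : (Matrix.of fun i j : Fin 2 => X e' i j) = Y := by
            ext i j; simp only [hXdef, if_true, Matrix.of_apply]
          show (fundamentalLatticeRep 2).ρ ((us s) e' * V e') = _
          rw [map_mul]
          congr 1
          show ((SUNBakryEmery.expSU (N := 2) (Y := Matrix.of fun i j : Fin 2 => X e' i j) (hXskew e') (hXtr e') s :
            Matrix.specialUnitaryGroup (Fin 2) ℂ) : Matrix (Fin 2) (Fin 2) ℂ) = _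
          rw [SUNBakryEmery.coe_expSU, hof]
          rfl
        -- the two curves agree
        have hfun : (fun t : ℝ => f (Function.update M e₀ (NormedSpace.exp (t • Y) * (fundamentalLatticeRep 2).ρ (V e')))) =
            fun s => g (coords (us s * V)) := by
          funext s
          show f _ = f _
          congr 1
          funext e''
          by_cases h : e'' = e₀
          · subst h
            rw [Function.update_self]
            show NormedSpace.exp (s • Y) * (fundamentalLatticeRep 2).ρ (V e') = (fun (ee : Edge 3 L) => Matrix.of fun (i j : Fin (fundamentalLatticeRep 2).N) => ((coords (us s * V) (ee, i, j, false) : ℝ) : ℂ) + ((coords (us s * V) (ee, i, j, true) : ℝ) : ℂ) * Complex.I) (torusEdge L e''.1)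
            rw [hreb (us s * V), ← hmove s, ← he₀]
            rfl
          · rw [Function.update_of_ne h]
            show (fundamentalLatticeRep 2).ρ (torusLift L V e''.1) = (fun (ee : Edge 3 L) => Matrix.of fun (i j : Fin (fundamentalLatticeRep 2).N) => ((coords (us s * V) (ee, i, j, false) : ℝ) : ℂ) + ((coords (us s * V) (ee, i, j, true) : ℝ) : ℂ) * Complex.I) (torusEdge L e''.1)
            rw [hreb (us s * V)]
            show (fundamentalLatticeRep 2).ρ (V (torusEdge L e''.1)) =
              Matrix.of fun i j : Fin (fundamentalLatticeRep 2).N => (fundamentalRep (Fin 2) ((us s * V) (torusEdge L e''.1)) : Matrix (Fin 2) (Fin 2) ℂ) i j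
            rw [hfix s _ (huniq e'' h)]
            rfl
        -- the derivative of `s ↦ g(coords(us s · V))` at `0`
        have hmf : HasDerivAt (fun s : ℝ => g (coords (us s * V))) (fderiv ℝ g (coords (us 0 * V)) (fun q : Edge 3 L × Fin (fundamentalLatticeRep 2).N × Fin (fundamentalLatticeRep 2).N × Bool => (fun z : ℂ => if q.2.2.2 then z.im else z.re) ((X q.1 * (fun (ee : Edge 3 L) => Matrix.of fun (i j : Fin (fundamentalLatticeRep 2).N) => ((coords (us 0 * V) (ee, i, j, false) : ℝ) : ℂ) + ((coords (us 0 * V) (ee, i, j, true) : ℝ) : ℂ) * Complex.I) q.1) q.2.1 q.2.2.1))) 0 :=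
          hasDerivAt_comp_coords_multiFlow (L := L) X hXskew hXtr V hgd 0
        have hdir : (fun q : Edge 3 L × Fin (fundamentalLatticeRep 2).N × Fin (fundamentalLatticeRep 2).N × Bool => (fun z : ℂ => if q.2.2.2 then z.im else z.re) ((X q.1 * (fun (ee : Edge 3 L) => Matrix.of fun (i j : Fin (fundamentalLatticeRep 2).N) => ((coords (us 0 * V) (ee, i, j, false) : ℝ) : ℂ) + ((coords (us 0 * V) (ee, i, j, true) : ℝ) : ℂ) * Complex.I) q.1) q.2.1 q.2.2.1)) =
            (fun q : Edge 3 L × Fin (fundamentalLatticeRep 2).N × Fin (fundamentalLatticeRep 2).N × Bool => if e' = q.1 then (fun z : ℂ => if q.2.2.2 then z.im else z.re) ((Y * (fundamentalLatticeRep 2).ρ (V e')) q.2.1 q.2.2.1) else 0) := by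
          rw [hus0]
          funext q
          by_cases hq : e' = q.1
          · rw [if_pos hq]
            have hXq : X q.1 = Y := by rw [hXdef]; exact if_pos hq.symm
            have hRq : (fun (ee : Edge 3 L) => Matrix.of fun (i j : Fin (fundamentalLatticeRep 2).N) => ((coords V (ee, i, j, false) : ℝ) : ℂ) + ((coords V (ee, i, j, true) : ℝ) : ℂ) * Complex.I) q.1 = (fundamentalLatticeRep 2).ρ (V q.1) := congrFun (hreb V) q.1
            rw [hXq, hRq, ← hq]
          · rw [if_neg hq]
            have hXq : X q.1 = 0 := by rw [hXdef]; exact if_neg (fun h => hq h.symm)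
            rw [hXq, Matrix.zero_mul]
            simp
        have hφder : HasDerivAt (fun s => g (coords (us s * V)))
            (fderiv ℝ g (coords V) (fun q : Edge 3 L × Fin (fundamentalLatticeRep 2).N × Fin (fundamentalLatticeRep 2).N × Bool => if e' = q.1 then (fun z : ℂ => if q.2.2.2 then z.im else z.re) ((Y * (fundamentalLatticeRep 2).ρ (V e')) q.2.1 q.2.2.1) else 0)) 0 := by
          rw [hdir, hus0] at hmf
          exact hmf
        rw [hfun]
        exact hφder.deriv
      have hMe : M e₀ = (fundamentalLatticeRep 2).ρ (V e') := by
        show (fundamentalLatticeRep 2).ρ (torusLift L V e₀.1) = _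
        show (fundamentalLatticeRep 2).ρ (V (torusEdge L e₀.1)) = _
        rw [he₀]
      unfold linkGradSq
      rw [hMe]
      refine Finset.sum_congr rfl fun α _ => ?_
      exact congrArg (fun r : ℝ => r ^ 2) (hder (SUNBakryEmery.frame_conjTranspose α) (SUNBakryEmery.frame_trace hN α)).symm
    · push Not at hex
      rw [Finset.sum_eq_zero fun e _ => if_neg (hex e)]
      refine Finset.sum_eq_zero fun α _ => ?_
      -- `g` does not depend on the link `e'`: `Ψ(δ_(e') A) = 0`
      have hzero : Ψ (fun q : Edge 3 L × Fin (fundamentalLatticeRep 2).N × Fin (fundamentalLatticeRep 2).N × Bool => if e' = q.1 then (fun z : ℂ => if q.2.2.2 then z.im else z.re)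
          ((SUNBakryEmery.frame α * (fundamentalLatticeRep 2).ρ (V e')) q.2.1 q.2.2.1) else 0) = 0 := by
        funext e; ext i j
        have hne : ¬ e' = torusEdge L e.1 := fun h => hex e h.symm
        rw [Pi.zero_apply, Matrix.zero_apply]
        show (((if e' = ((torusEdge L e.1, i, j, false) : Edge 3 L × Fin (fundamentalLatticeRep 2).N × Fin (fundamentalLatticeRep 2).N × Bool).1 then _ else (0 : ℝ)) : ℝ) : ℂ) +
          (((if e' = ((torusEdge L e.1, i, j, true) : Edge 3 L × Fin (fundamentalLatticeRep 2).N × Fin (fundamentalLatticeRep 2).N × Bool).1 then _ else (0 : ℝ)) : ℝ) : ℂ) * Complex.I = 0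
        rw [if_neg hne, if_neg hne]
        simp
      rw [hfderiv_g, hzero, map_zero]
      ring
  have step : ∀ e' : Edge 3 L,
      ∑ ν : NoiseIdx (fundamentalLatticeRep 2).N, fderiv ℝ g (coords V) (fun q : Edge 3 L × Fin (fundamentalLatticeRep 2).N × Fin (fundamentalLatticeRep 2).N × Bool => if (e', ν).1 = q.1 then (fun z : ℂ => if q.2.2.2 then z.im else z.re) (((Real.sqrt 2 : ℂ) • ((fundamentalLatticeRep 2).lieProj (noiseDir (e', ν).2) * (fun (ee : Edge 3 L) => Matrix.of fun (i j : Fin (fundamentalLatticeRep 2).N) => ((coords V (ee, i, j, false) : ℝ) : ℂ) + ((coords V (ee, i, j, true) : ℝ) : ℂ) * Complex.I) q.1)) q.2.1 q.2.2.1) else 0) * fderiv ℝ g (coords V) (fun q : Edge 3 L × Fin (fundamentalLatticeRep 2).N × Fin (fundamentalLatticeRep 2).N × Bool => if (e', ν).1 = q.1 then (fun z : ℂ => if q.2.2.2 then z.im else z.re) (((Real.sqrt 2 : ℂ) • ((fundamentalLatticeRep 2).lieProj (noiseDir (e', ν).2) * (fun (ee : Edge 3 L) => Matrix.of fun (i j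 : Fin (fundamentalLatticeRep 2).N) => ((coords V (ee, i, j, false) : ℝ) : ℂ) + ((coords V (ee, i, j, true) : ℝ) : ℂ) * Complex.I) q.1)) q.2.1 q.2.2.1) else 0) =
      2 * ∑ α : SUNBakryEmery.FrameIdx (fundamentalLatticeRep 2).N,
        (fderiv ℝ g (coords V) (fun q : Edge 3 L × Fin (fundamentalLatticeRep 2).N × Fin (fundamentalLatticeRep 2).N × Bool => if e' = q.1 then (fun z : ℂ => if q.2.2.2 then z.im else z.re)
          ((SUNBakryEmery.frame α * (fundamentalLatticeRep 2).ρ (V e')) q.2.1 q.2.2.1) else 0)) ^ 2 :=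
    fun e' => sum_frameDeriv_sq_eq_two_mul_sum_sq_dirDeriv g e' V
  rw [Finset.sum_congr rfl fun e' _ => step e', ← Finset.mul_sum]
  congr 1
  rw [Finset.sum_congr rfl fun e' _ => hterm e', Finset.sum_comm]
  refine Finset.sum_congr rfl fun e _ => ?_
  rw [Finset.sum_ite_eq Finset.univ (torusEdge L e.1) (fun _ => linkGradSq Λ f e M)]
  simp

end Dictionary

end Summit.QuantumFields.YangMills.Theorems.ColdStartUniversality
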